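import Mathlib.MeasureTheory.Integral.IntervalIntegral.FundThmCalculus
import Mathlib.Analysis.Calculus.BumpFunction.InnerProduct
import Mathlib.MeasureTheory.Function.ContinuousMapDense
import Mathlib.Analysis.Calculus.IteratedDeriv.Lemmas
import HarnessLib

/-!
# Yamada–Watanabe test functions adapted to an occupation measure

Topic `Analysis/FunctionSpaces`; real analysis only (no probability). Two ingredients of the
proof of the Yamada–Watanabe pathwise uniqueness theorem (Revuz–Yor, Ch. IX, Thm (3.5)(ii);
Yamada–Watanabe 1971, Thm 1) for a *Borel* modulus `ρ` (`∫_{0+} da/ρ(a) = +∞`), as carried out in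
`Literature/Analysis/FunctionSpaces/SquaredBesselProofs.lean`:

* `Literature.Analysis.FunctionSpaces.ywFun p`: for a continuous `p : ℝ → ℝ`, the even `C²`
  function `Φ` with `Φ(0) = Φ'(0) = 0` and `Φ'' = p ∘ |·|` (`ywDeriv p = Φ'`, two nested interval
  integrals). When `p ≥ 0` is supported in `(0, δ)` with `∫₀^δ p = 1` one gets `|Φ'| ≤ 1` and
  `|x| - δ ≤ Φ(x) ≤ |x|` (`sub_le_ywFun`, `ywFun_le_abs`): these are the functions `φₙ` of
  Yamada–Watanabe with `φₙ'' ` prescribed.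
* `Literature.Analysis.FunctionSpaces.exists_testDensity`: if `ρ > 0` is Borel on `(0, ∞)` with
  `∫₀^ε da/ρ(a) = ∞` for every `ε > 0`, and `ν` is a finite Borel measure on `ℝ` with
  `∫_{(0,∞)} ρ⁻¹ dν < ∞`, then for all `δ, ε > 0` there is a continuous compactly supported
  `p ≥ 0`, supported in `(0, δ)`, with `∫₀^δ p = 1` and `∫ p dν ≤ ε`. (Truncate `ρ⁻¹ 𝟙_{(0,δ)}`
  to a bounded `g` with `∫ g da` large but `∫ g dν ≤ ∫ ρ⁻¹ dν`, approximate `g` in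
  `L¹(da|_{(0,δ)} + ν)` by a continuous compactly supported function — Mathlib's
  `MeasureTheory.Integrable.exists_hasCompactSupport_integral_sub_le` — then cut off, take the
  positive part and normalise.) In the uniqueness proof `ν` is the expected occupation measure
  `ν(A) = E ∫₀ᵀ 𝟙_A(|D_s|) d⟨D⟩_s` of the difference `D` of two solutions, for which
  `∫ ρ⁻¹ dν ≤ T` is exactly the hypothesis `(σ(s,x) - σ(s,y))² ≤ ρ(|x - y|)`; this replaces the
  pointwise requirement `φₙ'' ρ ≤ 2/n` of Yamada–Watanabe (which needs a regular `ρ`) and the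
  local-time argument of Revuz–Yor (Le Gall), Ch. IX, Lemma (3.3).

## References

* T. Yamada, S. Watanabe, *On the uniqueness of solutions of stochastic differential equations*,
  J. Math. Kyoto Univ. 11 (1971), 155–167, Thm 1.
* D. Revuz, M. Yor, *Continuous Martingales and Brownian Motion* (3rd ed., 1999), Ch. IX, §3,
  Lemma (3.3), Cor. (3.4), Thm (3.5).
-/

open MeasureTheory Set Filter
open scoped Topology ENNReal NNReal

noncomputable section

namespace Literature.Analysis.FunctionSpaces

/-! ### Even `C²` test functions with prescribed second derivative -/

/-- `ywDeriv p x = ∫₀ˣ p |u| du`, the (odd) derivative of the test function `ywFun p`.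
Yamada–Watanabe (1971), proof of Thm 1 (the functions `φₙ'`). [cite: YamadaWatanabe1971, Thm 1] -/
def ywDeriv (p : ℝ → ℝ) (x : ℝ) : ℝ := ∫ u in (0 : ℝ)..x, p |u|

/-- `ywFun p x = ∫₀ˣ ywDeriv p y dy`: the even `C²` function `Φ` with `Φ(0) = Φ'(0) = 0` and
`Φ''(x) = p |x|`. Yamada–Watanabe (1971), proof of Thm 1 (the functions `φₙ`).
[cite: YamadaWatanabe1971, Thm 1] -/
def ywFun (p : ℝ → ℝ) (x : ℝ) : ℝ := ∫ y in (0 : ℝ)..x, ywDeriv p y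

section TestFunction

variable {p : ℝ → ℝ} {δ : ℝ}

/-- `u ↦ p |u|` is continuous for continuous `p`. [folklore] -/
theorem continuous_comp_abs (hp : Continuous p) : Continuous fun u ↦ p |u| :=
  hp.comp continuous_abs

/-- `(ywDeriv p)' = p ∘ |·|` (fundamental theorem of calculus). [folklore] -/
theorem hasDerivAt_ywDeriv (hp : Continuous p) (x : ℝ) : HasDerivAt (ywDeriv p) (p |x|) x :=
  ((continuous_comp_abs hp).integral_hasStrictDerivAt 0 x).hasDerivAt

/-- `deriv (ywDeriv p) = p ∘ |·|`. [folklore] -/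
theorem deriv_ywDeriv (hp : Continuous p) : deriv (ywDeriv p) = fun x ↦ p |x| :=
  funext fun x ↦ (hasDerivAt_ywDeriv hp x).deriv

/-- `ywDeriv p` is differentiable. [folklore] -/
theorem differentiable_ywDeriv (hp : Continuous p) : Differentiable ℝ (ywDeriv p) :=
  fun x ↦ (hasDerivAt_ywDeriv hp x).differentiableAt

/-- `ywDeriv p` is continuous. [folklore] -/
theorem continuous_ywDeriv (hp : Continuous p) : Continuous (ywDeriv p) :=
  (differentiable_ywDeriv hp).continuous

/-- `(ywFun p)' = ywDeriv p` (fundamental theorem of calculus). [folklore] -/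
theorem hasDerivAt_ywFun (hp : Continuous p) (x : ℝ) : HasDerivAt (ywFun p) (ywDeriv p x) x :=
  ((continuous_ywDeriv hp).integral_hasStrictDerivAt 0 x).hasDerivAt

/-- `deriv (ywFun p) = ywDeriv p`. [folklore] -/
theorem deriv_ywFun (hp : Continuous p) : deriv (ywFun p) = ywDeriv p :=
  funext fun x ↦ (hasDerivAt_ywFun hp x).deriv

/-- `ywFun p` is differentiable. [folklore] -/
theorem differentiable_ywFun (hp : Continuous p) : Differentiable ℝ (ywFun p) :=
  fun x ↦ (hasDerivAt_ywFun hp x).differentiableAt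

/-- `ywFun p` is continuous. [folklore] -/
theorem continuous_ywFun (hp : Continuous p) : Continuous (ywFun p) :=
  (differentiable_ywFun hp).continuous

/-- `(ywFun p)'' = p ∘ |·|`. [folklore] -/
theorem iteratedDeriv_two_ywFun (hp : Continuous p) :
    iteratedDeriv 2 (ywFun p) = fun x ↦ p |x| := by
  rw [show (2 : ℕ) = 1 + 1 from rfl, iteratedDeriv_succ, iteratedDeriv_one, deriv_ywFun hp,
    deriv_ywDeriv hp]

/-- `ywFun p` is of class `C²`. [folklore] -/
theorem contDiff_ywFun (hp : Continuous p) : ContDiff ℝ 2 (ywFun p) := by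
  have h1 : ContDiff ℝ 1 (ywDeriv p) := by
    refine contDiff_one_iff_deriv.2 ⟨differentiable_ywDeriv hp, ?_⟩
    rw [deriv_ywDeriv hp]
    exact continuous_comp_abs hp
  have h2 : ContDiff ℝ (1 + 1) (ywFun p) := by
    refine contDiff_succ_iff_deriv.2 ⟨differentiable_ywFun hp, fun h ↦ ?_, ?_⟩
    · exact absurd h WithTop.one_ne_top
    · rwa [deriv_ywFun hp]
  rwa [one_add_one_eq_two] at h2

/-- `ywDeriv p` is odd. [folklore] -/
theorem ywDeriv_neg (x : ℝ) : ywDeriv p (-x) = -ywDeriv p x := by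
  unfold ywDeriv
  have : ∫ u in (0 : ℝ)..-x, p |u| = ∫ u in (0 : ℝ)..-x, (fun v ↦ p |v|) (-u) := by
    simp only [abs_neg]
  rw [this, intervalIntegral.integral_comp_neg (fun v ↦ p |v|)]
  simp only [neg_neg, neg_zero]
  rw [intervalIntegral.integral_symm]

/-- `ywFun p` is even. [folklore] -/
theorem ywFun_neg (x : ℝ) : ywFun p (-x) = ywFun p x := by
  unfold ywFun
  have : ∫ y in (0 : ℝ)..-x, ywDeriv p y = ∫ y in x..(0 : ℝ), ywDeriv p (-y) := by
    rw [intervalIntegral.integral_comp_neg (fun y ↦ ywDeriv p y)]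
    simp only [neg_zero]
  rw [this]
  simp only [ywDeriv_neg, intervalIntegral.integral_neg]
  rw [intervalIntegral.integral_symm, neg_neg]

/-- `ywFun p 0 = 0`. [folklore] -/
@[simp] theorem ywFun_zero : ywFun p 0 = 0 := intervalIntegral.integral_same

/-- `ywDeriv p 0 = 0`. [folklore] -/
@[simp] theorem ywDeriv_zero : ywDeriv p 0 = 0 := intervalIntegral.integral_same

/-- `ywDeriv p ≥ 0` on `[0, ∞)` when `p ≥ 0`. [folklore] -/
theorem ywDeriv_nonneg (hp0 : ∀ x, 0 ≤ p x) {x : ℝ} (hx : 0 ≤ x) : 0 ≤ ywDeriv p x :=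
  intervalIntegral.integral_nonneg hx fun _ _ ↦ hp0 _

/-- On `[0, ∞)`, `ywDeriv p x = ∫₀ˣ p`. [folklore] -/
theorem ywDeriv_eq_of_nonneg {x : ℝ} (hx : 0 ≤ x) : ywDeriv p x = ∫ u in (0 : ℝ)..x, p u :=
  intervalIntegral.integral_congr fun u hu ↦ by
    rw [uIcc_of_le hx] at hu
    simp only [abs_of_nonneg hu.1]

/-- If `p` is supported in `(0, δ)` and `∫₀^δ p = 1`, then `ywDeriv p = 1` on `[δ, ∞)`.
[folklore] -/
theorem ywDeriv_of_le (hp : Continuous p) (hsupp : ∀ x, p x ≠ 0 → x ∈ Ioo 0 δ)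
    (hint : ∫ x in (0 : ℝ)..δ, p x = 1) (hδ : 0 < δ) {x : ℝ} (hx : δ ≤ x) : ywDeriv p x = 1 := by
  rw [ywDeriv_eq_of_nonneg (hδ.le.trans hx), ← intervalIntegral.integral_add_adjacent_intervals
    (b := δ) (hp.intervalIntegrable _ _) (hp.intervalIntegrable _ _), hint]
  have : ∫ u in δ..x, p u = ∫ _ in δ..x, (0 : ℝ) := by
    refine intervalIntegral.integral_congr fun u hu ↦ ?_
    rw [uIcc_of_le hx] at hu
    by_contra h
    exact (not_lt.2 hu.1) (hsupp u h).2
  rw [this, intervalIntegral.integral_zero, add_zero]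

/-- If `p ≥ 0` is supported in `(0, δ)` with `∫₀^δ p = 1`, then `ywDeriv p ≤ 1` on `[0, ∞)`.
[folklore] -/
theorem ywDeriv_le_one (hp : Continuous p) (hp0 : ∀ x, 0 ≤ p x)
    (hsupp : ∀ x, p x ≠ 0 → x ∈ Ioo 0 δ) (hint : ∫ x in (0 : ℝ)..δ, p x = 1) (hδ : 0 < δ)
    {x : ℝ} (hx : 0 ≤ x) : ywDeriv p x ≤ 1 := by
  rcases le_total δ x with hδx | hxδ
  · exact (ywDeriv_of_le hp hsupp hint hδ hδx).le
  · rw [ywDeriv_eq_of_nonneg hx, ← hint]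
    exact intervalIntegral.integral_mono_interval le_rfl hx hxδ (ae_of_all _ fun u ↦ hp0 u)
      (hp.intervalIntegrable _ _)

/-- If `p ≥ 0` is supported in `(0, δ)` with `∫₀^δ p = 1`, then `|ywDeriv p| ≤ 1`. [folklore] -/
theorem abs_ywDeriv_le_one (hp : Continuous p) (hp0 : ∀ x, 0 ≤ p x)
    (hsupp : ∀ x, p x ≠ 0 → x ∈ Ioo 0 δ) (hint : ∫ x in (0 : ℝ)..δ, p x = 1) (hδ : 0 < δ)
    (x : ℝ) : |ywDeriv p x| ≤ 1 := by
  rcases le_total 0 x with hx | hx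
  · rw [abs_of_nonneg (ywDeriv_nonneg hp0 hx)]
    exact ywDeriv_le_one hp hp0 hsupp hint hδ hx
  · have h := ywDeriv_le_one hp hp0 hsupp hint hδ (neg_nonneg.2 hx)
    have h0 := ywDeriv_nonneg hp0 (neg_nonneg.2 hx)
    rw [ywDeriv_neg] at h h0
    rw [abs_of_nonpos (by linarith)]
    linarith

/-- `ywFun p ≥ 0` on `[0, ∞)` when `p ≥ 0`. [folklore] -/
theorem ywFun_nonneg_of_nonneg (hp0 : ∀ x, 0 ≤ p x) {x : ℝ} (hx : 0 ≤ x) :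
    0 ≤ ywFun p x :=
  intervalIntegral.integral_nonneg hx fun _ hy ↦ ywDeriv_nonneg hp0 hy.1

/-- `ywFun p ≥ 0` when `p ≥ 0`. [folklore] -/
theorem ywFun_nonneg (hp0 : ∀ x, 0 ≤ p x) (x : ℝ) : 0 ≤ ywFun p x := by
  rcases le_total 0 x with hx | hx
  · exact ywFun_nonneg_of_nonneg hp0 hx
  · rw [← ywFun_neg]
    exact ywFun_nonneg_of_nonneg hp0 (neg_nonneg.2 hx)

/-- **Lower bound** `|x| - δ ≤ ywFun p x` for `p ≥ 0` supported in `(0, δ)` with `∫₀^δ p = 1`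
(so `ywFun p` approximates `|x|`: these are the `φₙ ↑ |x|` of Yamada–Watanabe).
Yamada–Watanabe (1971), proof of Thm 1. [cite: YamadaWatanabe1971, Thm 1] -/
theorem sub_le_ywFun (hp : Continuous p) (hp0 : ∀ x, 0 ≤ p x)
    (hsupp : ∀ x, p x ≠ 0 → x ∈ Ioo 0 δ) (hint : ∫ x in (0 : ℝ)..δ, p x = 1) (hδ : 0 < δ)
    (x : ℝ) : |x| - δ ≤ ywFun p x := by
  wlog hx : 0 ≤ x generalizing x
  · have := this (-x) (neg_nonneg.2 (le_of_not_ge hx))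
    rwa [abs_neg, ywFun_neg] at this
  rw [abs_of_nonneg hx]
  rcases le_total x δ with hxδ | hδx
  · linarith [ywFun_nonneg_of_nonneg hp0 hx]
  · unfold ywFun
    rw [← intervalIntegral.integral_add_adjacent_intervals (b := δ)
      ((continuous_ywDeriv hp).intervalIntegrable _ _)
      ((continuous_ywDeriv hp).intervalIntegrable _ _)]
    have h1 : 0 ≤ ∫ y in (0 : ℝ)..δ, ywDeriv p y :=
      intervalIntegral.integral_nonneg hδ.le fun y hy ↦ ywDeriv_nonneg hp0 hy.1
    have h2 : ∫ _ in δ..x, (1 : ℝ) ≤ ∫ y in δ..x, ywDeriv p y :=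
      intervalIntegral.integral_mono_on hδx (by simp)
        ((continuous_ywDeriv hp).intervalIntegrable _ _)
        fun y hy ↦ (ywDeriv_of_le hp hsupp hint hδ hy.1).ge
    rw [intervalIntegral.integral_const, smul_eq_mul, mul_one] at h2
    linarith

/-- **Upper bound** `ywFun p x ≤ |x|` (`|ywDeriv p| ≤ 1` and `ywFun p 0 = 0`).
Yamada–Watanabe (1971), proof of Thm 1. [cite: YamadaWatanabe1971, Thm 1] -/
theorem ywFun_le_abs (hp : Continuous p) (hp0 : ∀ x, 0 ≤ p x)
    (hsupp : ∀ x, p x ≠ 0 → x ∈ Ioo 0 δ) (hint : ∫ x in (0 : ℝ)..δ, p x = 1) (hδ : 0 < δ)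
    (x : ℝ) : ywFun p x ≤ |x| := by
  wlog hx : 0 ≤ x generalizing x
  · have := this (-x) (neg_nonneg.2 (le_of_not_ge hx))
    rwa [abs_neg, ywFun_neg] at this
  rw [abs_of_nonneg hx]
  unfold ywFun
  have := intervalIntegral.integral_mono_on hx ((continuous_ywDeriv hp).intervalIntegrable _ _)
    (by simp : IntervalIntegrable (fun _ ↦ (1 : ℝ)) volume 0 x)
    fun y _ ↦ (le_abs_self _).trans (abs_ywDeriv_le_one hp hp0 hsupp hint hδ y)
  simpa using this

/-- `|ywFun p x| ≤ |x|`. [folklore] -/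
theorem abs_ywFun_le_abs (hp : Continuous p) (hp0 : ∀ x, 0 ≤ p x)
    (hsupp : ∀ x, p x ≠ 0 → x ∈ Ioo 0 δ) (hint : ∫ x in (0 : ℝ)..δ, p x = 1) (hδ : 0 < δ)
    (x : ℝ) : |ywFun p x| ≤ |x| := by
  rw [abs_of_nonneg (ywFun_nonneg hp0 x)]
  exact ywFun_le_abs hp hp0 hsupp hint hδ x

end TestFunction

/-! ### Test densities adapted to a finite measure -/

section TestDensity

/-- Pointwise comparison used in `exists_testDensity`: cutting off and taking the positive part
of an approximant `q` of a nonnegative `g` supported where the cut-off equals `1` does not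
increase the error. [folklore] -/
theorem abs_mul_max_sub_le {χ q g : ℝ} (hχ0 : 0 ≤ χ) (hχ1 : χ ≤ 1) (hg : 0 ≤ g)
    (h : g ≠ 0 → χ = 1) : |χ * max q 0 - g| ≤ |g - q| := by
  by_cases hg0 : g = 0
  · rw [hg0, sub_zero, zero_sub, abs_neg, abs_of_nonneg (mul_nonneg hχ0 (le_max_right _ _))]
    calc χ * max q 0 ≤ 1 * max q 0 := mul_le_mul_of_nonneg_right hχ1 (le_max_right _ _)
      _ = max q 0 := one_mul _
      _ ≤ |q| := max_le (le_abs_self q) (abs_nonneg q)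
  · rw [h hg0, one_mul]
    have := abs_max_sub_max_le_max q 0 g 0
    rw [max_eq_left hg, sub_self, abs_zero] at this
    rw [abs_sub_comm g q]
    exact this.trans (max_le le_rfl (abs_nonneg _))

/-- **Test densities adapted to a finite measure.** Let `ρ` be Borel and strictly positive on
`(0, ∞)` with `∫₀^ε da/ρ(a) = ∞` for every `ε > 0` (`a ↦ (ρ a)⁻¹` integrable on no `(0, ε)`), and
let `ν` be a finite Borel measure on `ℝ` with `∫_{(0,∞)} (ρ a)⁻¹ dν(a) < ∞`. Then for all
`δ, ε > 0` there is a continuous, compactly supported `p ≥ 0`, supported in `(0, δ)`, with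
`∫₀^δ p(a) da = 1` and `∫ p dν ≤ ε`. This is the measure-theoretic substitute for the choice
`0 ≤ φₙ'' ≤ 2/(nρ)`, `∫ φₙ'' = 1` of Yamada–Watanabe (possible only for regular `ρ`): with
`ν` the expected occupation measure of the difference of two solutions weighted by `d⟨D⟩`, the
hypothesis `∫ ρ⁻¹ dν < ∞` is Revuz–Yor's `∫₀ᵗ ρ(X¹ - X²)⁻¹ d⟨X¹ - X², X¹ - X²⟩ ≤ t` (proof of
Cor. (3.4)), and the conclusion is what the Itô-formula estimate needs.
Yamada–Watanabe (1971), proof of Thm 1; Revuz–Yor (1999), Ch. IX, Lemma (3.3) and Cor. (3.4).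
[cite: RevuzYor1999, Ch. IX Lemma (3.3) and Cor. (3.4)] -/
theorem exists_testDensity {ρ : ℝ → ℝ} (hρm : Measurable ρ) (hρpos : ∀ a, 0 < a → 0 < ρ a)
    (hρint : ∀ ε, 0 < ε → ¬ IntegrableOn (fun a ↦ (ρ a)⁻¹) (Set.Ioo 0 ε))
    (ν : Measure ℝ) [IsFiniteMeasure ν] (hν : ∫⁻ a in Set.Ioi 0, ENNReal.ofReal (ρ a)⁻¹ ∂ν ≠ ∞)
    {δ ε : ℝ} (hδ : 0 < δ) (hε : 0 < ε) :
    ∃ p : ℝ → ℝ, Continuous p ∧ HasCompactSupport p ∧ (∀ x, 0 ≤ p x) ∧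
      (∀ x, p x ≠ 0 → x ∈ Set.Ioo 0 δ) ∧ (∫ x in (0 : ℝ)..δ, p x = 1) ∧
      Integrable p ν ∧ ∫ x, p x ∂ν ≤ ε := by
  set f : ℝ → ℝ := fun a ↦ (ρ a)⁻¹ with hf
  have hfm : Measurable f := hρm.inv
  have hf0 : ∀ a, 0 < a → 0 < f a := fun a ha ↦ inv_pos.2 (hρpos a ha)
  -- (1) `∫_{(0,δ)} f = ∞` as a lower Lebesgue integral
  have hdiv : ∫⁻ a in Ioo 0 δ, ENNReal.ofReal (f a) = ∞ := by
    by_contra hne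
    refine hρint δ hδ ⟨hfm.aestronglyMeasurable, ?_⟩
    rw [hasFiniteIntegral_iff_ofReal]
    · exact lt_top_iff_ne_top.2 hne
    · exact (ae_restrict_mem measurableSet_Ioo).mono fun a ha ↦ (hf0 a ha.1).le
  -- (2) bounded compactly supported truncations `g n ↑ f 𝟙_{(0,δ)}`
  set S : ℕ → Set ℝ := fun n ↦ Icc (1 / ((n : ℝ) + 1)) (δ - 1 / ((n : ℝ) + 1)) with hS
  set g : ℕ → ℝ → ℝ := fun n ↦ (S n).indicator fun a ↦ min (f a) ((n : ℝ) + 1) with hg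
  have hS_sub : ∀ n : ℕ, S n ⊆ Ioo 0 δ := fun n a ha ↦
    ⟨lt_of_lt_of_le (by positivity) ha.1,
      lt_of_le_of_lt ha.2 (sub_lt_self _ (by positivity))⟩
  have hS_mono : ∀ {n m : ℕ}, n ≤ m → S n ⊆ S m := by
    intro n m hnm a ha
    have h1 : 1 / ((m : ℝ) + 1) ≤ 1 / ((n : ℝ) + 1) :=
      one_div_le_one_div_of_le (by positivity) (by exact_mod_cast Nat.succ_le_succ hnm)
    exact ⟨h1.trans ha.1, ha.2.trans (by linarith)⟩
  have hg_meas : ∀ n, Measurable (g n) := fun n ↦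
    (hfm.min measurable_const).indicator measurableSet_Icc
  have hg0 : ∀ n a, 0 ≤ g n a := fun n a ↦
    indicator_nonneg (fun b hb ↦ le_min (hf0 b (hS_sub n hb).1).le (by positivity)) a
  have hg_le_f : ∀ n a, a ∈ Ioo 0 δ → g n a ≤ f a := by
    intro n a ha
    simp only [hg]
    by_cases hmem : a ∈ S n
    · rw [indicator_of_mem hmem]
      exact min_le_left _ _
    · rw [indicator_of_notMem hmem]
      exact (hf0 a ha.1).le
  have hg_bdd : ∀ n a, g n a ≤ (n : ℝ) + 1 := by
    intro n a
    simp only [hg]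
    by_cases hmem : a ∈ S n
    · rw [indicator_of_mem hmem]
      exact min_le_right _ _
    · rw [indicator_of_notMem hmem]
      positivity
  have hg_supp : ∀ n a, g n a ≠ 0 → a ∈ S n := fun n a h ↦ by
    by_contra hh
    exact h (indicator_of_notMem hh _)
  have hg_mono : Monotone fun n a ↦ ENNReal.ofReal (g n a) := by
    intro n m hnm a
    apply ENNReal.ofReal_le_ofReal
    simp only [hg]
    by_cases ha : a ∈ S n
    · rw [indicator_of_mem ha, indicator_of_mem (hS_mono hnm ha)]
      exact min_le_min_left _ (by exact_mod_cast Nat.succ_le_succ hnm)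
    · rw [indicator_of_notMem ha]
      exact hg0 m a
  have hg_sup : ∀ a, (⨆ n, ENNReal.ofReal (g n a)) =
      (Ioo 0 δ).indicator (fun a ↦ ENNReal.ofReal (f a)) a := by
    intro a
    by_cases ha : a ∈ Ioo 0 δ
    · rw [indicator_of_mem ha]
      apply le_antisymm (iSup_le fun n ↦ ENNReal.ofReal_le_ofReal (hg_le_f n a ha))
      obtain ⟨N, hN⟩ := exists_nat_ge (max (max a⁻¹ (δ - a)⁻¹) (f a))
      have hN1 : a⁻¹ ≤ (N : ℝ) + 1 := by
        linarith [le_max_left (max a⁻¹ (δ - a)⁻¹) (f a), le_max_left a⁻¹ (δ - a)⁻¹]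
      have hN2 : (δ - a)⁻¹ ≤ (N : ℝ) + 1 := by
        linarith [le_max_left (max a⁻¹ (δ - a)⁻¹) (f a), le_max_right a⁻¹ (δ - a)⁻¹]
      have hN3 : f a ≤ (N : ℝ) + 1 := by
        linarith [le_max_right (max a⁻¹ (δ - a)⁻¹) (f a)]
      have hmem : a ∈ S N := by
        have hda : 0 < δ - a := sub_pos.2 ha.2
        constructor
        · rw [one_div_le (by positivity) ha.1, one_div]
          exact hN1
        · have : 1 / ((N : ℝ) + 1) ≤ δ - a := by
            rw [one_div_le (by positivity) hda, one_div]
            exact hN2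
          linarith
      refine le_iSup_of_le N (le_of_eq ?_)
      simp only [hg]
      rw [indicator_of_mem hmem, min_eq_left hN3]
    · rw [indicator_of_notMem ha]
      have : ∀ n, g n a = 0 := fun n ↦ indicator_of_notMem (fun h ↦ ha (hS_sub n h)) _
      simp [this]
  have hlim : (⨆ n, ∫⁻ a, ENNReal.ofReal (g n a)) = ∞ := by
    rw [← lintegral_iSup (fun n ↦ (hg_meas n).ennreal_ofReal) hg_mono,
      lintegral_congr fun a ↦ hg_sup a, lintegral_indicator measurableSet_Ioo, hdiv]
  -- (3) the level `n`: large integral, and `1/(n+1) < δ/4`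
  set I₀ : ℝ := (∫⁻ a in Ioi 0, ENNReal.ofReal (f a) ∂ν).toReal with hI₀
  have hI₀0 : 0 ≤ I₀ := ENNReal.toReal_nonneg
  set Λ : ℝ := (I₀ + 1) / ε with hΛ
  have hΛ0 : 0 < Λ := by positivity
  obtain ⟨n₁, hn₁⟩ : ∃ n : ℕ, ENNReal.ofReal (Λ + 1) < ∫⁻ a, ENNReal.ofReal (g n a) := by
    have : ENNReal.ofReal (Λ + 1) < ⨆ n, ∫⁻ a, ENNReal.ofReal (g n a) := by
      rw [hlim]
      exact ENNReal.ofReal_lt_top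
    exact lt_iSup_iff.1 this
  obtain ⟨n₂, hn₂⟩ := exists_nat_gt (4 / δ)
  set n : ℕ := max n₁ n₂ with hn
  have hn_int : ENNReal.ofReal (Λ + 1) < ∫⁻ a, ENNReal.ofReal (g n a) :=
    lt_of_lt_of_le hn₁ (lintegral_mono fun a ↦ hg_mono (le_max_left n₁ n₂) a)
  have hnδ : 1 / ((n : ℝ) + 1) < δ / 4 := by
    have h1 : (4 : ℝ) / δ < (n : ℝ) + 1 := by
      have : (n₂ : ℝ) ≤ n := by exact_mod_cast le_max_right n₁ n₂
      linarith
    rw [div_lt_iff₀ hδ] at h1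
    rw [one_div_lt (by positivity) (by positivity)]
    calc 1 / (δ / 4) = 4 / δ := by rw [one_div_div]
      _ < (n : ℝ) + 1 := by
        have : (n₂ : ℝ) ≤ n := by exact_mod_cast le_max_right n₁ n₂
        linarith
  -- (4) the finite measure `μ = da|_{(0,δ)} + ν` and integrability of `g n`
  set μ : Measure ℝ := volume.restrict (Ioo 0 δ) + ν with hμ
  haveI hfin1 : IsFiniteMeasure (volume.restrict (Ioo (0 : ℝ) δ)) :=
    isFiniteMeasure_restrict.2 (by simp)
  haveI : IsFiniteMeasure μ := by rw [hμ]; infer_instance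
  have hgi : Integrable (g n) μ :=
    (integrable_const ((n : ℝ) + 1)).mono' (hg_meas n).aestronglyMeasurable
      (ae_of_all _ fun a ↦ by
        rw [Real.norm_eq_abs, abs_of_nonneg (hg0 n a)]
        exact hg_bdd n a)
  -- (5) continuous compactly supported approximation in `L¹(μ)`
  obtain ⟨q, -, hq, hqc, hqi⟩ :=
    hgi.exists_hasCompactSupport_integral_sub_le (by norm_num : (0 : ℝ) < 1 / 2)
  -- (6) cut-off and positive part
  let χ : ContDiffBump (δ / 2 : ℝ) :=
    ⟨δ / 2 - 1 / ((n : ℝ) + 1), δ / 2 - 1 / (2 * ((n : ℝ) + 1)), by linarith, by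
      have : 1 / (2 * ((n : ℝ) + 1)) < 1 / ((n : ℝ) + 1) :=
        one_div_lt_one_div_of_lt (by positivity) (by linarith [show (0:ℝ) < (n:ℝ) + 1 by positivity])
      linarith⟩
  have hrIn : χ.rIn = δ / 2 - 1 / ((n : ℝ) + 1) := rfl
  have hrOut : χ.rOut = δ / 2 - 1 / (2 * ((n : ℝ) + 1)) := rfl
  have hχ1 : ∀ x ∈ S n, χ x = 1 := by
    intro x hx
    apply χ.one_of_mem_closedBall
    rw [Real.closedBall_eq_Icc, hrIn]
    exact ⟨by linarith [hx.1], by linarith [hx.2]⟩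
  have hχsupp : ∀ x, χ x ≠ 0 → x ∈ Ioo (1 / (2 * ((n : ℝ) + 1))) (δ - 1 / (2 * ((n : ℝ) + 1))) := by
    intro x hx
    have : x ∈ Function.support (χ : ℝ → ℝ) := hx
    rw [χ.support_eq, Real.ball_eq_Ioo, hrOut] at this
    exact ⟨by linarith [this.1], by linarith [this.2]⟩
  set p₀ : ℝ → ℝ := fun x ↦ χ x * max (q x) 0 with hp₀
  have hp₀c : Continuous p₀ := χ.continuous.mul (hqc.max continuous_const)
  have hp₀0 : ∀ x, 0 ≤ p₀ x := fun x ↦ mul_nonneg (χ.nonneg) (le_max_right _ _)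
  have hp₀supp : ∀ x, p₀ x ≠ 0 → x ∈ Ioo 0 δ := by
    intro x hx
    have hχx : χ x ≠ 0 := fun h ↦ hx (by simp only [hp₀, h, zero_mul])
    have := hχsupp x hχx
    exact ⟨lt_trans (by positivity) this.1, lt_trans this.2 (sub_lt_self _ (by positivity))⟩
  have hp₀cs : HasCompactSupport p₀ := χ.hasCompactSupport.mul_right
  have hpt : ∀ x, ‖p₀ x - g n x‖ ≤ ‖g n x - q x‖ := by
    intro x
    rw [Real.norm_eq_abs, Real.norm_eq_abs]
    exact abs_mul_max_sub_le χ.nonneg χ.le_one (hg0 n x) fun h ↦ hχ1 x (hg_supp n x h)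
  -- (7) the integral estimates
  have hp₀i : ∀ (κ : Measure ℝ) [IsFiniteMeasure κ], Integrable p₀ κ := fun κ _ ↦
    hp₀c.integrable_of_hasCompactSupport hp₀cs
  have herr : ∫ x, ‖p₀ x - g n x‖ ∂μ ≤ 1 / 2 :=
    (integral_mono ((hp₀i μ).sub hgi).norm (hgi.sub hqi).norm hpt).trans hq
  have hgi1 : Integrable (g n) (volume.restrict (Ioo 0 δ)) :=
    hgi.mono_measure (Measure.le_add_right le_rfl)
  have hgi2 : Integrable (g n) ν := hgi.mono_measure (Measure.le_add_left le_rfl)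
  have hI1 : Integrable (fun x ↦ ‖p₀ x - g n x‖) (volume.restrict (Ioo 0 δ)) :=
    ((hp₀i _).sub hgi1).norm
  have hI2 : Integrable (fun x ↦ ‖p₀ x - g n x‖) ν := ((hp₀i _).sub hgi2).norm
  have hsplit : ∫ x, ‖p₀ x - g n x‖ ∂μ =
      (∫ x, ‖p₀ x - g n x‖ ∂(volume.restrict (Ioo 0 δ))) + ∫ x, ‖p₀ x - g n x‖ ∂ν := by
    rw [hμ]
    exact integral_add_measure hI1 hI2
  rw [hsplit] at herr
  have hnn1 : 0 ≤ ∫ x, ‖p₀ x - g n x‖ ∂(volume.restrict (Ioo 0 δ)) :=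
    integral_nonneg fun x ↦ norm_nonneg _
  have hnn2 : 0 ≤ ∫ x, ‖p₀ x - g n x‖ ∂ν := integral_nonneg fun x ↦ norm_nonneg _
  have herr1 : ∫ x, ‖p₀ x - g n x‖ ∂(volume.restrict (Ioo 0 δ)) ≤ 1 / 2 := by linarith
  have herr2 : ∫ x, ‖p₀ x - g n x‖ ∂ν ≤ 1 / 2 := by linarith
  -- (7a) `∫_{(0,δ)} p₀ ≥ Λ + 1/2`
  have hgvol : Λ + 1 < ∫ x in Ioo 0 δ, g n x := by
    have hsupp : Function.support (g n) ⊆ Ioo 0 δ := fun x hx ↦ hS_sub n (hg_supp n x hx)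
    have hgi0 : Integrable (g n) volume :=
      (integrableOn_iff_integrable_of_support_subset hsupp).1 hgi1
    rw [setIntegral_eq_integral_of_forall_compl_eq_zero fun x hx ↦
      Function.notMem_support.1 fun h ↦ hx (hsupp h)]
    have h := hn_int
    rw [← ofReal_integral_eq_lintegral_ofReal hgi0 (ae_of_all _ (hg0 n)),
      ENNReal.ofReal_lt_ofReal_iff'] at h
    exact h.1
  have hp₀vol : Λ + 1 / 2 ≤ ∫ x in Ioo 0 δ, p₀ x := by
    have h1 : |∫ x in Ioo 0 δ, (p₀ x - g n x)| ≤ 1 / 2 :=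
      (abs_integral_le_integral_abs).trans herr1
    rw [integral_sub ((hp₀i _)) hgi1] at h1
    have := (abs_sub_lt_iff.1 (lt_of_le_of_lt h1 (by norm_num : (1:ℝ)/2 < 1))).2
    linarith [(abs_le.1 h1).1]
  -- (7b) `∫ p₀ dν ≤ I₀ + 1/2`
  have hgν : ∫ x, g n x ∂ν ≤ I₀ := by
    rw [integral_eq_lintegral_of_nonneg_ae (ae_of_all _ (hg0 n)) (hg_meas n).aestronglyMeasurable,
      hI₀]
    refine ENNReal.toReal_mono hν ?_
    rw [← lintegral_indicator measurableSet_Ioi]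
    refine lintegral_mono fun a ↦ ?_
    by_cases ha : a ∈ Ioo 0 δ
    · rw [indicator_of_mem (show a ∈ Ioi 0 from ha.1)]
      exact ENNReal.ofReal_le_ofReal (hg_le_f n a ha)
    · have : g n a = 0 := indicator_of_notMem (fun h ↦ ha (hS_sub n h)) _
      rw [this, ENNReal.ofReal_zero]
      exact zero_le
  have hp₀ν : ∫ x, p₀ x ∂ν ≤ I₀ + 1 / 2 := by
    have h1 : |∫ x, (p₀ x - g n x) ∂ν| ≤ 1 / 2 := (abs_integral_le_integral_abs).trans herr2
    rw [integral_sub (hp₀i _) hgi2] at h1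
    linarith [(abs_le.1 h1).2]
  -- (8) normalisation
  set c : ℝ := ∫ x in (0 : ℝ)..δ, p₀ x with hc
  have hc_eq : c = ∫ x in Ioo 0 δ, p₀ x := by
    rw [hc, intervalIntegral.integral_of_le hδ.le, integral_Ioc_eq_integral_Ioo]
  have hc_ge : Λ + 1 / 2 ≤ c := hc_eq ▸ hp₀vol
  have hc0 : 0 < c := lt_of_lt_of_le (by positivity) hc_ge
  refine ⟨fun x ↦ p₀ x / c, hp₀c.div_const c, ?_, fun x ↦ div_nonneg (hp₀0 x) hc0.le,
    fun x hx ↦ hp₀supp x (fun h ↦ hx (by simp only [h, zero_div])), ?_, (hp₀i ν).div_const c, ?_⟩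
  · simp_rw [div_eq_mul_inv]
    exact hp₀cs.mul_right
  · rw [intervalIntegral.integral_div, ← hc, div_self hc0.ne']
  · rw [integral_div]
    rw [div_le_iff₀ hc0]
    have h1 : I₀ + 1 / 2 ≤ ε * (Λ + 1 / 2) := by
      rw [hΛ, mul_add, mul_div_cancel₀ _ hε.ne']
      linarith
    calc ∫ x, p₀ x ∂ν ≤ I₀ + 1 / 2 := hp₀ν
      _ ≤ ε * (Λ + 1 / 2) := h1
      _ ≤ ε * c := mul_le_mul_of_nonneg_left hc_ge hε.le

end TestDensity

end Literature.Analysis.FunctionSpaces
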